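import Mathlib
import Summits.ResolutionOfSingularities.ResolutionOfSingularities.Theorems.FrobeniusLadderFRationalResolutionCompletedBaseChangeFibreStalks
import Summits.ResolutionOfSingularities.ResolutionOfSingularities.Theorems.FrobeniusLadderFRationalResolutionCompletedBaseChangeFibreLocalization
import Summits.ResolutionOfSingularities.ResolutionOfSingularities.Theorems.FrobeniusLadderFRationalResolutionCompletedBaseChangeFibreChart
import Literature.AlgebraicGeometry.Resolution.BlowupChartTransition

/-!
# Crux `FrobeniusLadder.FRationalResolution` (stmt-ResolutionOfSingularities-15317), line `redirect`,
# stub `stub_diagonalizableQuotientResolution` — THE DOWN DIRECTION for the two-step ÉTALE descent (ε), finiteness: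
# finitely many singular points of `Bl_{IC_𝔮}(Spec C_𝔮)` ⇒ finitely many singular points of `Bl_I(Spec C)` over `V(𝔮)`

Companion of `…CompletedBaseChangeFibreDown` (the `hloc` half). For `C` of finite type over a field, `𝔮` maximal, `I = (x₁, …, x_n)`:
* ★★★ **`finite_singular_over_of_finite_localization`** — if `X₁' = Bl_{IC_𝔮}(Spec C_𝔮)` has finitely many singular points, then
  `X₁ = Bl_I(Spec C)` has finitely many singular points over `V(𝔮)`. Chart by chart (`finite_not_isRegularLocalRing_blowupAlgebra_of_finite`):
  the non-regular primes of `C_𝔮[IC_𝔮/x_i]` inject into the singular points of `X₁'` (`…Stalks.nonempty_ringEquiv_stalk_awayι`), so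
  they are finitely many; the non-regular primes of `C[I/x_i]` over `𝔮` are the contractions of those
  (`…Chart.existsUnique_isPrime_comap_eq_blowupAlgebra`, `…isRegularLocalRing_iff_blowupAlgebra` with `B = C_𝔮`, `…Localization`);
  and every singular point of `X₁` over `𝔮` lies on such a chart prime (`…BlowupChartPoints.exists_chart_point_prime`).

Honest label: plumbing toward ONE leaf stub (no stub, crux or summit closed). No definitions, no named facts, no sorry.
[cite: StacksProject, Tag 0804; Tag 02C5] [cite: Matsumura1987, Thm. 8.14] [cite: GortzWedhorn2020, (13.19) p. 415]
-/

noncomputable section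

-- single-problem summit: the doubled namespace component is forced
set_option linter.dupNamespace false

open IsLocalRing AlgebraicGeometry CategoryTheory
open scoped TensorProduct
open Literature.AlgebraicGeometry.Resolution

namespace Summit.ResolutionOfSingularities.ResolutionOfSingularities.Theorems.FRationalResolution.CompletedBaseChangeFibreDownFinite

/-- Chart level: finitely many singular points of `Bl_J(Spec R)` ⇒ finitely many non-regular primes of each chart ring `R[J/a]`
(the chart map `Spec R[J/a] ≅ D₊(a t) ⊆ Bl_J(Spec R)` is injective on points and matches the local rings).
[cite: StacksProject, Tag 0804] [folklore] -/
theorem finite_not_isRegularLocalRing_blowupAlgebra_of_finite {R : Type} [CommRing R] [IsNoetherianRing R] (J : Ideal R)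
    (a : R) (ha : a ∈ J) (hfin : (Scheme.regularLocus (affineBlowup J))ᶜ.Finite) :
    {𝔑 : PrimeSpectrum (blowupAlgebra J a) | ¬ IsRegularLocalRing (Localization.AtPrime 𝔑.asIdeal)}.Finite := by
  classical
  -- the chart map on points: `𝔑 ↦ awayι (rCE⁻¹ 𝔑)`
  let G : PrimeSpectrum (blowupAlgebra J a) → affineBlowup J := fun 𝔑 =>
    Proj.awayι (reesGrading J) (reesT a ha) (reesT_mem a ha) one_pos
      (PrimeSpectrum.comap (reesChartEquiv (I := J) a ha).toRingHom 𝔑)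
  have hGinj : Function.Injective G := by
    intro 𝔑₁ 𝔑₂ h
    have h1 := (Proj.awayι (reesGrading J) (reesT a ha) (reesT_mem a ha) one_pos).isOpenEmbedding.injective h
    exact PrimeSpectrum.comap_injective_of_surjective _ (reesChartEquiv (I := J) a ha).surjective h1
  refine Set.Finite.of_finite_image (hfin.subset ?_) hGinj.injOn
  rintro _ ⟨𝔑, h𝔑, rfl⟩
  haveI := 𝔑.isPrime
  obtain ⟨e_w⟩ := CompletedBaseChangeFibreStalks.nonempty_ringEquiv_stalk_awayι J a ha
    (PrimeSpectrum.comap (reesChartEquiv (I := J) a ha).toRingHom 𝔑) 𝔑.asIdeal (fun _ => Iff.rfl)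
  intro hreg
  rw [Scheme.mem_regularLocus] at hreg
  apply h𝔑
  haveI := hreg
  exact IsRegularLocalRing.of_ringEquiv (R' := Localization.AtPrime 𝔑.asIdeal) e_w

/-- ★★★ **Finiteness DOWN from the localization.** `C` of finite type over a field `K`, `𝔮` maximal, `I = (x₁, …, x_n)`: if
`Bl_{IC_𝔮}(Spec C_𝔮)` has finitely many singular points, then `Bl_I(Spec C)` has finitely many singular points over `V(𝔮)`.
[cite: StacksProject, Tag 0804; Tag 02C5] [cite: Matsumura1987, Thm. 8.14] [cite: GortzWedhorn2020, (13.19) p. 415] -/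
theorem finite_singular_over_of_finite_localization (K : Type) [Field K] (C : Type) [CommRing C] [Algebra K C]
    [Algebra.FiniteType K C] (𝔮 : Ideal C) [𝔮.IsMaximal] {n : ℕ} (x : Fin n → C) (I : Ideal C)
    (hI : I = Ideal.span (Set.range x))
    (hfin' : (Scheme.regularLocus (affineBlowup (I.map (algebraMap C (Localization.AtPrime 𝔮)))))ᶜ.Finite) :
    {z : affineBlowup I | 𝔮 ≤ (affineBlowup.π I z).asIdeal ∧
      ¬ IsRegularLocalRing ((affineBlowup I).presheaf.stalk z)}.Finite := by
  classical
  haveI : IsNoetherianRing C := Algebra.FiniteType.isNoetherianRing K C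
  haveI := CompletedBaseChangeFibreLocalization.flat_localization_atPrime C 𝔮
  have hxI : ∀ i, x i ∈ I := fun i => hI ▸ Ideal.subset_span ⟨i, rfl⟩
  have hIle : I ≤ Ideal.span (Set.range x) := hI.le
  haveI : ∀ i, IsNoetherianRing (blowupAlgebra I (x i)) := fun i =>
    isNoetherianRing_blowupAlgebra_of_isNoetherianRing I (x i)
  haveI : IsNoetherianRing (Localization.AtPrime 𝔮) :=
    IsLocalization.isNoetherianRing 𝔮.primeCompl (Localization.AtPrime 𝔮) inferInstance
  haveI : ∀ i, IsNoetherianRing (blowupAlgebra (I.map (algebraMap C (Localization.AtPrime 𝔮)))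
      (algebraMap C (Localization.AtPrime 𝔮) (x i))) := fun i => isNoetherianRing_blowupAlgebra_of_isNoetherianRing _ _
  have hres := CompletedBaseChangeFibreLocalization.forall_exists_sub_mem_localization_atPrime C 𝔮
  have hinj := CompletedBaseChangeFibreLocalization.comap_map_le_localization_atPrime C 𝔮
  have hxI' : ∀ i, algebraMap C (Localization.AtPrime 𝔮) (x i) ∈ I.map (algebraMap C (Localization.AtPrime 𝔮)) := fun i =>
    Ideal.mem_map_of_mem _ (hxI i)
  -- the finite sets of singular chart primes upstairs, then downstairs over `𝔮` (image under `ψ⁻¹`)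
  have hS' : ∀ i : Fin n, {𝔑' : PrimeSpectrum (blowupAlgebra (I.map (algebraMap C (Localization.AtPrime 𝔮)))
      (algebraMap C (Localization.AtPrime 𝔮) (x i))) | ¬ IsRegularLocalRing (Localization.AtPrime 𝔑'.asIdeal)}.Finite :=
    fun i => finite_not_isRegularLocalRing_blowupAlgebra_of_finite _ _ (hxI' i) hfin'
  have hS : ∀ i : Fin n, {𝔫 : PrimeSpectrum (blowupAlgebra I (x i)) |
      𝔮.map (algebraMap C (blowupAlgebra I (x i))) ≤ 𝔫.asIdeal ∧
        ¬ IsRegularLocalRing (Localization.AtPrime 𝔫.asIdeal)}.Finite := by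
    intro i
    refine Set.Finite.subset ((hS' i).image (PrimeSpectrum.comap
      (blowupAlgebraMap (algebraMap C (Localization.AtPrime 𝔮)) I (I.map (algebraMap C (Localization.AtPrime 𝔮))) (x i)
        le_rfl))) ?_
    rintro 𝔫 ⟨h𝔫, hreg⟩
    haveI := 𝔫.isPrime
    obtain ⟨𝔑', ⟨h𝔑'p, h𝔑'c⟩, -⟩ := CompletedBaseChangeFibreChart.existsUnique_isPrime_comap_eq_blowupAlgebra I
      (I.map (algebraMap C (Localization.AtPrime 𝔮))) (x i) le_rfl le_rfl 𝔮 hres hinj 𝔫.asIdeal h𝔫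
    haveI := h𝔑'p
    have h𝔫' : 𝔮.map (algebraMap C (blowupAlgebra I (x i))) ≤ 𝔑'.comap (blowupAlgebraMap (algebraMap C
        (Localization.AtPrime 𝔮)) I (I.map (algebraMap C (Localization.AtPrime 𝔮))) (x i) le_rfl) := by
      rw [h𝔑'c]; exact h𝔫
    have hiff := CompletedBaseChangeFibreChart.isRegularLocalRing_iff_blowupAlgebra I
      (I.map (algebraMap C (Localization.AtPrime 𝔮))) (x i) le_rfl le_rfl 𝔮 hres 𝔑' h𝔫'
    refine ⟨⟨𝔑', h𝔑'p⟩, ?_, ?_⟩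
    · intro hreg'
      apply hreg
      have h1 := hiff.mpr hreg'
      have htr := BlowupChartPoints.isRegularLocalRing_localization_iff_of_ringEquiv (RingEquiv.refl (blowupAlgebra I (x i)))
        (𝔑'.comap (blowupAlgebraMap (algebraMap C (Localization.AtPrime 𝔮)) I
          (I.map (algebraMap C (Localization.AtPrime 𝔮))) (x i) le_rfl)) 𝔫.asIdeal
        (fun s => by rw [h𝔑'c]; exact Iff.rfl)
      exact htr.mp h1
    · exact PrimeSpectrum.ext h𝔑'c
  -- the chart maps on points, downstairs
  let G : ∀ i : Fin n, PrimeSpectrum (blowupAlgebra I (x i)) → affineBlowup I := fun i 𝔫 =>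
    Proj.awayι (reesGrading I) (reesT (x i) (hxI i)) (reesT_mem (x i) (hxI i)) one_pos
      (PrimeSpectrum.comap (reesChartEquiv (I := I) (x i) (hxI i)).toRingHom 𝔫)
  refine Set.Finite.subset (Set.finite_iUnion fun i => (hS i).image (G i)) ?_
  rintro z ⟨hz𝔮, hz⟩
  obtain ⟨i, q, 𝔫', h𝔫'p, hq, hmemq, hcomap, hiff⟩ := BlowupChartPoints.exists_chart_point_prime I x hxI hIle z
  haveI := h𝔫'p
  refine Set.mem_iUnion.mpr ⟨i, ⟨𝔫', h𝔫'p⟩, ⟨?_, fun hreg => hz (hiff.mpr hreg)⟩, ?_⟩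
  · change 𝔮.map (algebraMap C (blowupAlgebra I (x i))) ≤ 𝔫'
    rw [Ideal.map_le_iff_le_comap, hcomap]
    exact hz𝔮
  · have hpt : PrimeSpectrum.comap (reesChartEquiv (I := I) (x i) (hxI i)).toRingHom ⟨𝔫', h𝔫'p⟩ = q := by
      refine PrimeSpectrum.ext ?_
      ext s
      rw [PrimeSpectrum.comap_asIdeal, Ideal.mem_comap, hmemq]
      exact Iff.rfl
    rw [← hq, ← hpt]

end Summit.ResolutionOfSingularities.ResolutionOfSingularities.Theorems.FRationalResolution.CompletedBaseChangeFibreDownFinite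

end
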